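import Summits.BirchSwinnertonDyer.Rank1Residual.X11b.VisibilityRankOne
import Summits.BirchSwinnertonDyer.Rank1Residual.X11b.ChaRoute
import Literature.NumberTheory.EllipticCurves.Rank1Residual.Typed.SelmerCardCertificate
import HarnessLib

/-!
# BSD rank-≤1 residual cell, class X11b: `BSD(E,p)` at a RANK-ONE pair with `p² ‖ #Ш_an` from
# Kolyvagin's / Cha's index bound (upper half) and the EXACT `p`-DESCENT count `#Sel^(p) = p³`
# (lower half) — no congruent partner curve, no Cassels–Tate

HONEST FRAMING (cell `b2b-bsdres-*`, run/shared/lean/b2b/bsd-rank1-residual/, verbatim): the goal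
of the cell is to DELETE the COMBINATION-SHAPED residual classes for ALL analytic-rank `≤ 1` elliptic
curves over `ℚ` — "full BSD formula for every rank `≤ 1` curve in class C" assembled STRICTLY from
published theorems — so that the rank-`≤ 1` remainder becomes exactly the CONSTRUCTION-SHAPED
classes, which are TYPED (missing-input Props), NOT attempted; this is not "finishing BSD".
Unit `b2b-bsdres-x11b` (X11 prover B, `p = 3`), gen 9. Class X11b stays CONSTRUCTION-SHAPED
(REFEREE R6.2); this file is PER PAIR (a certificate shape), not a class theorem; no named fact is
introduced (theorems only); nothing is booked here (the lane books).

## What this file does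

The companion of x11c's `X11b/VisibilityRankOne.lean` (UPPER half Kolyvagin, LOWER half a VISIBLE
`Ш(E)[p] ≠ 0` from a `p`-congruent curve of rank `≥ 3` + Cassels–Tate). Here the LOWER half comes
from the curve itself: the exact `p`-descent count.

* §1 (any number field `K`, any rank): **`#Sel^(p)(E/K) = p^(rank E(K) + j)` and `E(K)[p] = 0`
  give `p^j ∣ #Ш(E/K)`** (`pow_dvd_shaOrder_of_card_selmerGroup`). From the tree's PROVED
  fundamental exact sequence `0 → E(K)/pE(K) → Sel^(p)(E/K) → Ш(E/K)[p] → 0` (`selmer_exact_holds`,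
  Silverman AEC X.4.2(a)) and `[E(K) : pE(K)] = p^{rank}·#E(K)[p]` (Mordell–Weil + descent count,
  tree theorem `natCard_quotient_nsmulRange_point_eq`, via x11c's
  `index_range_zsmul_eq_pow_rank_mul_card_torsionBy`): `#Ш(E/K)[p] = p^j` exactly, a subgroup of
  `Ш(E/K)` (Lagrange; `#Ш := Nat.card`, junk `0` if infinite, so no finiteness is needed).
* §2 (over `ℚ`, rank one, `ord_p #Ш_an = 2`): **`BSD(E,p)`** from the UPPER half
  `ord_p #Ш(E/ℚ) ≤ 2·ord_p [E(K) : ℤ y_K] ≤ 2` — either Kolyvagin's bound in McCallum's /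
  Gross's printed form (`ρ̄_{E,p}` onto; x11c's `padicValNat_shaOrder_le_of_kolyvagin`, PUBLISHED named
  facts `kolyvagin`, `Kolyvagin1990_padicValNat_card_sha_le`) or Cha 2005 (`ρ̄_{E,p}` irreducible,
  `p ∤ 2d_K`, `p² ∤ N`, non-CM; named fact `Cha2005.thm52_padicValNat_shaOrder_le` as printed by
  Miller 2011 Thm. 5.2 / GJPST 2009 Thm. 3.5) at a Heegner datum with `ord_p [E(K) : ℤ y_K] ≤ 1` —
  and the LOWER half `p² ∣ #Ш(E/ℚ)` of §1 with `j = 2`, i.e. the certificate `#Sel^(p)(E/ℚ) = p³`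
  (`E(ℚ)[p] = 0` is automatic: `E[p]` irreducible ⇒ no rational `p`-torsion, Mazur). GZK (`hGZK`,
  bsd.S17) supplies `rank E(ℚ) = r_an = 1` and the finiteness of `Ш(E/ℚ)`. NO Cassels–Tate pairing
  and NO partner curve enter.
* §3: the class shapes `ClassX11b.…` and the `p = 3` reading.

Where it bites (numbers, not adjectives; `HOME/b2b-bsdres-x11b/sel3x5e5/`, X11B-AUDIT §18): of the
lane's 20 798 X11b@3 rank-one RESIDUE classes at `N < 5·10⁵` (v4u), **79 have `#Ш_an = 9`**; gen 8's
GRH census found `dim_𝔽₃ Sel^(3)(E/ℚ) = 3` at all 79 (the exhibited elements make `Ш(E)[3] ⊇ (ℤ/3)²`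
unconditional; equality `#Sel₃ = 27` is what the EXACT mode certifies), and **74 of the 79 have
`3 ∤ ∏ c_q`**, so that at any Heegner field `K` with `3 ∤ #Ш_an(E^{d_K})` the Gross–Zagier bookkeeping
gives `ord₃ [E(K) : ℤ y_K] = 1` exactly (the lane's index computation): UPPER `≤ 2`, LOWER `≥ 2`,
`BSD(E,3)`. The x11c gen-6 visibility route reached 12 of these classes (those with a `3`-congruent
rank-`3` Cremona curve); this route needs no partner.

References: McCallum 1991 §1 [McCallumLMS1991]; Gross 1991 Thm. 1.3 [GrossLMS1991]; Cha 2005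
[Cha2005] as printed in Miller 2011 Thm. 5.2 [Miller2011LMS] and GJPST 2009 Thm. 3.5
[GrigorovJorzaPatrikisSteinTarnita2009]; Silverman AEC X.4.2, VIII.6.7 [SilvermanAEC2009];
Schaefer–Stoll 2004 (the `p`-descent that produces `#Sel^(p)`) [SchaeferStoll2004]; Miller 2011
Def. 1.1 [Miller2011LMS]; Mazur 1977 III.§5 [Mazur1977]; cell files `X11b/VisibilityRankOne.lean`,
`X11b/ChaRoute.lean`, `Typed/SelmerCardCertificate.lean`, `Typed/KolyvaginCertificate.lean`.
-/

noncomputable section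

open scoped Classical

open WeierstrassCurve Literature.NumberTheory.EllipticCurves
  Literature.NumberTheory.EllipticCurves.Rank1Residual
  Literature.NumberTheory.EllipticCurves.Rank1Residual.Typed
  Literature.NumberTheory.EllipticCurves.Cha2005
open NumberField IsDedekindDomain

namespace Summit.BirchSwinnertonDyer.Rank1Residual.X11b

/-! ### §1. `#Sel^(p)(E/K) = p^(rank + j)` and `E(K)[p] = 0` give `p^j ∣ #Ш(E/K)` -/

section Lower

variable {K : Type} [Field K] [NumberField K] (W : WeierstrassCurve K) [W.IsElliptic]
  (p : ℕ) [Fact p.Prime]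

/-- **The exact `p`-descent count as a LOWER bound for `Ш`**: over a number field `K`, if
`#Sel^(p)(E/K) = p ^ (rank E(K) + j)` and `E(K)[p] = 0`, then `p ^ j ∣ #Ш(E/K)`. Proof: by the
fundamental exact sequence (`selmer_exact_holds`) the map `Sel^(p) → H¹(K,E)` has kernel
`≅ E(K)/pE(K)`, of order `p^{rank}·#E(K)[p] = p^{rank}` (Mordell–Weil), and image `Ш(E/K)[p]`; so
`#Ш(E/K)[p] · p^{rank} = #Sel^(p) = p^{rank + j}`, `#Ш(E/K)[p] = p^j`, and `Ш(E/K)[p] ≤ Ш(E/K)`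
(Lagrange, `Nat.card`). This is the shape in which an EXACT `p`-descent (Schaefer–Stoll) reports
`dim_{𝔽_p} Ш(E/K)[p] = j`. [cite: SilvermanAEC2009, Thm. X.4.2(a) and Thm. VIII.6.7]
[cite: SchaeferStoll2004, §1 (the `p`-Selmer group computed as a subgroup of `A^×/(A^×)^p`)] -/
theorem pow_dvd_shaOrder_of_card_selmerGroup {j : ℕ}
    (hcard : Nat.card (W.selmerGroup (p : ℤ)) = p ^ (W.mordellWeilRank + j))
    (htors : Nat.card (AddSubgroup.torsionBy W.toAffine.Point (p : ℤ)) = 1) :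
    p ^ j ∣ W.shaOrder := by
  have hp : p.Prime := Fact.out
  have hp0 : (p : ℤ) ≠ 0 := by exact_mod_cast hp.ne_zero
  obtain ⟨κ, hker, hrange, hmap⟩ := selmer_exact_holds W (p : ℤ) hp0
  -- `#im κ = [E(K) : pE(K)] = p ^ rank`
  have hcardR : Nat.card κ.range = p ^ W.mordellWeilRank := by
    have h1 : Nat.card (W.toAffine.Point ⧸ κ.ker) = Nat.card κ.range :=
      Nat.card_congr (QuotientAddGroup.quotientKerEquivRange κ).toEquiv
    have h2 : Nat.card (W.toAffine.Point ⧸ κ.ker) = κ.ker.index := rfl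
    rw [← h1, h2, hker, index_range_zsmul_eq_pow_rank_mul_card_torsionBy W hp.ne_zero, htors,
      mul_one]
  -- `g : Sel^(p) → H¹(K, E)`, the restriction of `H¹(K, E[p]) → H¹(K, E)`
  set Sel : AddSubgroup (W.galH1Torsion (p : ℤ)) := W.selmerGroup (p : ℤ) with hSel
  set g : Sel →+ W.galH1 := (W.torsionH1ToH1 (p : ℤ)).comp Sel.subtype with hg
  have hgr : g.range = W.sha ⊓ AddSubgroup.torsionBy W.galH1 (p : ℤ) := by
    rw [hg, AddMonoidHom.range_comp, AddSubgroup.range_subtype, hmap]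
  -- `ker g ↪ im κ`
  have hkerle : g.ker.map Sel.subtype ≤ κ.range := by
    intro x hx
    obtain ⟨y, hy, rfl⟩ := AddSubgroup.mem_map.mp hx
    rw [hrange]
    refine AddSubgroup.mem_inf.mpr ⟨y.2, ?_⟩
    rw [AddMonoidHom.mem_ker] at hy ⊢
    simpa [hg] using hy
  haveI : Finite Sel :=
    Nat.finite_of_card_ne_zero (by rw [hcard]; exact pow_ne_zero _ hp.ne_zero)
  haveI : Finite κ.range :=
    Nat.finite_of_card_ne_zero (by rw [hcardR]; exact pow_ne_zero _ hp.ne_zero)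
  have hkdvd : Nat.card g.ker ∣ p ^ W.mordellWeilRank := by
    rw [← hcardR, ← AddSubgroup.card_map_of_injective (K := g.ker) Sel.subtype_injective]
    exact AddSubgroup.card_dvd_of_le hkerle
  -- `#Sel = #ker g · #im g`
  have hmul : Nat.card g.ker * Nat.card g.range = p ^ (W.mordellWeilRank + j) := by
    rw [← hcard, ← Nat.card_congr (QuotientAddGroup.quotientKerEquivRange g).toEquiv, mul_comm,
      ← AddSubgroup.card_eq_card_quotient_mul_card_addSubgroup]
  -- hence `p ^ j ∣ #im g`
  have hrdvd : p ^ j ∣ Nat.card g.range := by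
    obtain ⟨m, hm⟩ := hkdvd
    have hk0 : 0 < Nat.card g.ker := Nat.card_pos
    have h : Nat.card g.ker * Nat.card g.range = Nat.card g.ker * (m * p ^ j) := by
      rw [hmul, pow_add, hm]; ring
    rw [Nat.eq_of_mul_eq_mul_left hk0 h]
    exact Dvd.intro_left m rfl
  -- and `im g = Ш(E/K)[p] ≤ Ш(E/K)`
  calc p ^ j ∣ Nat.card g.range := hrdvd
    _ ∣ W.shaOrder := by
        rw [hgr, WeierstrassCurve.shaOrder]
        exact AddSubgroup.card_dvd_of_le inf_le_left

/-- **Rank-one reading: `#Sel^(p)(E/K) = p³`, `rank E(K) = 1`, `E(K)[p] = 0` ⇒ `p² ∣ #Ш(E/K)`** —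
`Ш(E/K)[p] ≅ (ℤ/p)²`. [cite: SilvermanAEC2009, Thm. X.4.2(a)] -/
theorem sq_dvd_shaOrder_of_card_selmerGroup_eq_cube
    (hcard : Nat.card (W.selmerGroup (p : ℤ)) = p ^ 3) (hrank : W.mordellWeilRank = 1)
    (htors : Nat.card (AddSubgroup.torsionBy W.toAffine.Point (p : ℤ)) = 1) :
    p ^ 2 ∣ W.shaOrder :=
  pow_dvd_shaOrder_of_card_selmerGroup W p (j := 2) (by rw [hrank]; exact hcard) htors

end Lower

/-! ### §2. `BSD(E,p)` at a rank-one pair with `ord_p #Ш_an = 2`: index bound + exact descent -/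

section Assembly

variable (W : WeierstrassCurve ℚ) [W.IsElliptic] (p : ℕ) [Fact p.Prime]

omit [W.IsElliptic] in
/-- **The typed LOWER half** (`MissingLowerBoundAt`: `ord_p #Ш_an ≤ ord_p #Ш`) at a pair with
`#Ш_an = s`, `ord_p s ≤ 2`, from `p² ∣ #Ш(E/ℚ)` and `Ш(E/ℚ)` finite. Bookkeeping (no Cassels–Tate).
[cite: Miller2011LMS, Def. 1.1] -/
theorem missingLowerBoundAt_of_sq_dvd (hfin : W.ShaFinite) {s : ℚ} (hs : shaAn W = (s : ℂ))
    (hv : padicValRat p s ≤ 2) (hdvd : p ^ 2 ∣ W.shaOrder) : MissingLowerBoundAt W p := by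
  have hn : W.shaOrder ≠ 0 := (WeierstrassCurve.shaOrder_pos W hfin).ne'
  have hle : 2 ≤ padicValNat p W.shaOrder := (padicValNat_dvd_iff_le hn).mp hdvd
  exact ⟨s, hs, hv.trans (by exact_mod_cast hle)⟩

/-- **Rank one, odd `p`, `ρ̄_{E,p}` onto, `ord_p #Ш_an = 2`: `BSD(E,p)` from PUBLISHED theorems plus
TWO per-pair certificates of the curve itself — Kolyvagin's Heegner datum with
`ord_p [E(K) : ℤ y_K] ≤ 1` (UPPER half) and the exact `p`-descent count `#Sel^(p)(E/ℚ) = p³` (LOWER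
half).** Published binders: `kolyvagin` (`hKo`), `Kolyvagin1990_padicValNat_card_sha_le` (`hB`,
McCallum 1991 §1 / Gross 1991 Thm. 1.3 (2)), Gross–Zagier–Kolyvagin (`hGZK`, bsd.S17:
`rank E(ℚ) = r_an = 1`, `Ш(E/ℚ)` finite). Per-pair data (explicit binders, finite computations about
DEFINED objects): the Heegner field `K` with the Heegner hypothesis for the level `N`, the Heegner
point `P` of infinite order and `ord_p [E(K) : ℤ P] ≤ 1`; `#Sel^(p)(E/ℚ) = p³` (Schaefer–Stoll
`p`-descent in EXACT mode); `#Ш_an = s` with `ord_p s = 2`. Then `ord_p #Ш(E/ℚ) = 2 = ord_p s`.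
`E(ℚ)[p] = 0` is automatic (surjective ⇒ irreducible ⇒ no rational `p`-torsion, Mazur). No
Cassels–Tate, no partner curve. NOT a class theorem; no label changes; the lane certifies.
[cite: McCallumLMS1991, §1 Theorem (Kolyvagin), p. 296] [cite: GrossLMS1991, §1 Thm. 1.3 (2), p. 236]
[cite: SilvermanAEC2009, Thm. X.4.2(a)] [cite: Miller2011LMS, §1 and Def. 1.1]
[cite: Mazur1977, Ch. III §5, p. 157] -/
theorem bsdp_of_kolyvagin_of_card_selmer (hGZK : rank_eq_analyticRank_of_analyticRank_le_one)
    {N : ℕ} [NeZero N] {K : Type} [Field K] [NumberField K] (hKo : kolyvagin N W K)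
    (hB : Kolyvagin1990_padicValNat_card_sha_le N W K) (hK : IsImaginaryQuadratic K)
    (hH : SatisfiesHeegnerHypothesis N K) {P : (W.baseChange K).toAffine.Point}
    (hP : IsHeegnerPoint N W K P) (hnt : ¬ IsOfFinAddOrder P)
    (hp2 : p ≠ 2) (hρ : W.HasSurjectiveModNGaloisRep p)
    (hI : padicValNat p (AddSubgroup.zmultiples P).index ≤ 1)
    (hr : W.analyticRank = 1) {s : ℚ} (hs : shaAn W = (s : ℂ)) (hv : padicValRat p s = 2)
    (hcard : Nat.card (W.selmerGroup (p : ℤ)) = p ^ 3) :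
    BSDp W p := by
  obtain ⟨hrk, hfin⟩ := hGZK W (by omega)
  have hirr : Irr W p := hasIrreducibleModPGaloisRep_of_hasSurjectiveModNGaloisRep W p hρ
  -- LOWER half: `p² ∣ #Ш(E/ℚ)` from the Selmer count (no rational `p`-torsion since `E[p]` is
  -- irreducible, Mazur)
  have hdvd : p ^ 2 ∣ W.shaOrder :=
    sq_dvd_shaOrder_of_card_selmerGroup_eq_cube W p hcard (by rw [hrk, hr])
      ((natCard_torsionBy_point_eq_of_subsingleton W _ _ _).trans
        (natCard_torsionBy_eq_one_of_hasIrreducibleModPGaloisRep W p hirr))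
  have hlow : MissingLowerBoundAt W p :=
    missingLowerBoundAt_of_sq_dvd W p hfin hs hv.le hdvd
  -- UPPER half: Kolyvagin
  have hup : MissingUpperBoundAt W p :=
    missingUpperBoundAt_of_padicValNat_shaOrder_le W p (k := 1)
      (padicValNat_shaOrder_le_of_kolyvagin W p hKo hB hK hH hP hnt hp2 hρ hfin hI)
      hs (by rw [hv]; norm_num)
  exact bsdp_of_missingPPartAt W p hGZK (by omega) (missingPPartAt_of_lower_of_upper W p hlow hup)

variable [W.IsGloballyMinimal]

/-- **Rank one, odd `p`, `E[p]` IRREDUCIBLE (image not necessarily surjective), `E` non-CM,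
`ord_p #Ш_an = 2`: `BSD(E,p)` from PUBLISHED theorems plus the two per-pair certificates** — Cha's
Heegner datum (`p ∤ d_K`, `p² ∤ N`, `y_K` of infinite order, `ord_p [E(K) : ℤ y_K] ≤ 1`; UPPER half
by the named fact `Cha2005.thm52_padicValNat_shaOrder_le` = Miller 2011 Thm. 5.2 / GJPST 2009
Thm. 3.5, flag `Cha05-primary-unread`) and the exact descent count `#Sel^(p)(E/ℚ) = p³` (LOWER half,
§1). GZK (`hGZK`) gives rank `1` and finiteness. No Cassels–Tate, no partner curve. Per pair; NOT a
class theorem. [cite: Miller2011LMS, Thm. 5.2 (arXiv:1010.2431 p. 11) and Def. 1.1]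
[cite: GrigorovJorzaPatrikisSteinTarnita2009, §3.1 Thm. 3.5 (Cha)] [cite: SilvermanAEC2009, Thm. X.4.2(a)]
[cite: Mazur1977, Ch. III §5, p. 157] -/
theorem bsdp_of_cha_of_card_selmer (hCha : thm52_padicValNat_shaOrder_le)
    (hGZK : rank_eq_analyticRank_of_analyticRank_le_one) (hcm : ¬ W.HasCM) (hp2 : p ≠ 2)
    (hirr : Irr W p)
    {N : ℕ} [NeZero N] {K : Type} [Field K] [NumberField K] (hK : IsImaginaryQuadratic K)
    (hH : SatisfiesHeegnerHypothesis N K) {P : (W.baseChange K).toAffine.Point}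
    (hP : IsHeegnerPoint N W K P) (hnt : ¬ IsOfFinAddOrder P)
    (hpD : ¬ (p : ℤ) ∣ NumberField.discr K) (hpN : ¬ p ^ 2 ∣ N)
    (hI : padicValNat p (AddSubgroup.zmultiples P).index ≤ 1)
    (hr : W.analyticRank = 1) {s : ℚ} (hs : shaAn W = (s : ℂ)) (hv : padicValRat p s = 2)
    (hcard : Nat.card (W.selmerGroup (p : ℤ)) = p ^ 3) :
    BSDp W p := by
  obtain ⟨hrk, hfin⟩ := hGZK W (by omega)
  -- LOWER half
  have hdvd : p ^ 2 ∣ W.shaOrder :=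
    sq_dvd_shaOrder_of_card_selmerGroup_eq_cube W p hcard (by rw [hrk, hr])
      ((natCard_torsionBy_point_eq_of_subsingleton W _ _ _).trans
        (natCard_torsionBy_eq_one_of_hasIrreducibleModPGaloisRep W p hirr))
  have hlow : MissingLowerBoundAt W p :=
    missingLowerBoundAt_of_sq_dvd W p hfin hs hv.le hdvd
  -- UPPER half: Cha
  have hle : padicValNat p W.shaOrder ≤ 2 * 1 :=
    (hCha W N K hK hH P hP hnt p hcm hp2 hpD hpN hirr (by omega)).trans (Nat.mul_le_mul_left 2 hI)
  have hup : MissingUpperBoundAt W p :=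
    missingUpperBoundAt_of_padicValNat_shaOrder_le W p (k := 1) hle hs (by rw [hv]; norm_num)
  exact bsdp_of_missingPPartAt W p hGZK (by omega) (missingPPartAt_of_lower_of_upper W p hlow hup)

/-- **The same at a MULTIPLICATIVE prime: non-CM discharged** (a CM curve has no multiplicative
prime, `not_mult_of_hasCM`, Silverman ATAEC II.6.4). [cite: Miller2011LMS, Thm. 5.2 and Def. 1.1]
[cite: SilvermanATAEC1994, Thm. II.6.4 (PDF p. 148)] -/
theorem bsdp_of_mult_of_cha_of_card_selmer (hCha : thm52_padicValNat_shaOrder_le)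
    (hGZK : rank_eq_analyticRank_of_analyticRank_le_one) (hmult : Mult W p) (hp2 : p ≠ 2)
    (hirr : Irr W p)
    {N : ℕ} [NeZero N] {K : Type} [Field K] [NumberField K] (hK : IsImaginaryQuadratic K)
    (hH : SatisfiesHeegnerHypothesis N K) {P : (W.baseChange K).toAffine.Point}
    (hP : IsHeegnerPoint N W K P) (hnt : ¬ IsOfFinAddOrder P)
    (hpD : ¬ (p : ℤ) ∣ NumberField.discr K) (hpN : ¬ p ^ 2 ∣ N)
    (hI : padicValNat p (AddSubgroup.zmultiples P).index ≤ 1)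
    (hr : W.analyticRank = 1) {s : ℚ} (hs : shaAn W = (s : ℂ)) (hv : padicValRat p s = 2)
    (hcard : Nat.card (W.selmerGroup (p : ℤ)) = p ^ 3) :
    BSDp W p :=
  bsdp_of_cha_of_card_selmer W p hCha hGZK (fun hCM ↦ not_mult_of_hasCM W hCM p hmult) hp2 hirr hK
    hH hP hnt hpD hpN hI hr hs hv hcard

end Assembly

/-! ### §3. Class shapes -/

section ClassShapes

variable (W : WeierstrassCurve ℚ) [W.IsElliptic] (p : ℕ) [Fact p.Prime]

/-- **X11b at an odd `p` with `ρ̄_{E,p}` onto and `ord_p #Ш_an = 2`: `BSD(E,p)` from PUBLISHED theorems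
(Kolyvagin via McCallum/Gross; Gross–Zagier–Kolyvagin) plus the two per-pair certificates of
`bsdp_of_kolyvagin_of_card_selmer`** (`ClassX11b W p` supplies `r_an = 1` and `p ≠ 2`). SUB-class
statement; NOT a deletion of the class; the lane certifies pairs and owns verdicts.
[cite: McCallumLMS1991, §1 Theorem (Kolyvagin), p. 296] [cite: SilvermanAEC2009, Thm. X.4.2(a)]
[cite: Miller2011LMS, §1 and Def. 1.1] -/
theorem ClassX11b.bsdp_of_kolyvagin_of_card_selmer
    (hGZK : rank_eq_analyticRank_of_analyticRank_le_one) (hX : ClassX11b W p)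
    {N : ℕ} [NeZero N] {K : Type} [Field K] [NumberField K] (hKo : kolyvagin N W K)
    (hB : Kolyvagin1990_padicValNat_card_sha_le N W K) (hK : IsImaginaryQuadratic K)
    (hH : SatisfiesHeegnerHypothesis N K) {P : (W.baseChange K).toAffine.Point}
    (hP : IsHeegnerPoint N W K P) (hnt : ¬ IsOfFinAddOrder P) (hρ : Surj W p)
    (hI : padicValNat p (AddSubgroup.zmultiples P).index ≤ 1)
    {s : ℚ} (hs : shaAn W = (s : ℂ)) (hv : padicValRat p s = 2)
    (hcard : Nat.card (W.selmerGroup (p : ℤ)) = p ^ 3) : BSDp W p :=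
  _root_.Summit.BirchSwinnertonDyer.Rank1Residual.X11b.bsdp_of_kolyvagin_of_card_selmer W p hGZK hKo
    hB hK hH hP hnt hX.2.1 hρ hI hX.1 hs hv hcard

variable [W.IsGloballyMinimal]

/-- **X11b at an odd `p`, `E[p]` irreducible (ANY image), `ord_p #Ш_an = 2`: `BSD(E,p)` from PUBLISHED
theorems (Cha 2005 as printed by Miller/GJPST; Gross–Zagier–Kolyvagin) plus the two per-pair
certificates of `bsdp_of_mult_of_cha_of_card_selmer`** — every Galois / reduction / CM hypothesis of
Cha's theorem holds by definition of the class; what remains per pair is the Heegner field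
(`p ∤ d_K`), `p² ∤ N`, the index valuation `≤ 1`, `#Sel^(p)(E/ℚ) = p³` and `ord_p #Ш_an = 2`.
SUB-class statement; NOT a deletion of the class. [cite: Miller2011LMS, Thm. 5.2 and Def. 1.1]
[cite: GrigorovJorzaPatrikisSteinTarnita2009, §3.1 Thm. 3.5 (Cha)] [cite: SilvermanAEC2009, Thm. X.4.2(a)] -/
theorem ClassX11b.bsdp_of_cha_of_card_selmer (hCha : thm52_padicValNat_shaOrder_le)
    (hGZK : rank_eq_analyticRank_of_analyticRank_le_one) (hX : ClassX11b W p)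
    {N : ℕ} [NeZero N] {K : Type} [Field K] [NumberField K] (hK : IsImaginaryQuadratic K)
    (hH : SatisfiesHeegnerHypothesis N K) {P : (W.baseChange K).toAffine.Point}
    (hP : IsHeegnerPoint N W K P) (hnt : ¬ IsOfFinAddOrder P)
    (hpD : ¬ (p : ℤ) ∣ NumberField.discr K) (hpN : ¬ p ^ 2 ∣ N)
    (hI : padicValNat p (AddSubgroup.zmultiples P).index ≤ 1)
    {s : ℚ} (hs : shaAn W = (s : ℂ)) (hv : padicValRat p s = 2)
    (hcard : Nat.card (W.selmerGroup (p : ℤ)) = p ^ 3) : BSDp W p := by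
  obtain ⟨hr1, hp2, hmult, hirr⟩ := hX
  exact bsdp_of_mult_of_cha_of_card_selmer W p hCha hGZK hmult hp2 hirr hK hH hP hnt hpD hpN hI hr1
    hs hv hcard

/-- **X11 at `p = 3`, the `#Ш_an = 9` rows: `BSD(E,3)` from PUBLISHED theorems plus the lane's
Heegner-index certificate `ord₃ [E(K) : ℤ y_K] ≤ 1` and this unit's EXACT `3`-descent certificate
`#Sel^(3)(E/ℚ) = 27`** (`ClassX11 W 3` = mult(3) ∧ irr(3) supplies Cha's hypotheses; `9 ∤ N` is the
binder `hpN` on the level of the Heegner datum, dischargeable by Carayol as in `X11b/ChaRoute.lean`).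
On the lane's v4u residue at `N < 5·10⁵`: 79 X11b@3 rank-one classes have `#Ш_an = 9`, 74 of them
with `3 ∤ ∏ c_q` (index valuation `1` at a field with `3 ∤ #Ш_an(E^{d_K})`); table
`HOME/b2b-bsdres-x11b/sel3x5e5/`. Per pair; X11 ∧ r = 1 ∧ p = 3 stays CONSTRUCTION-SHAPED (R6.2).
[cite: Miller2011LMS, Thm. 5.2 and Def. 1.1] [cite: SilvermanAEC2009, Thm. X.4.2(a)] -/
theorem X11.bsdp_three_of_cha_of_card_selmerThree (hCha : thm52_padicValNat_shaOrder_le)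
    (hGZK : rank_eq_analyticRank_of_analyticRank_le_one) (hX : ClassX11 W 3)
    {N : ℕ} [NeZero N] {K : Type} [Field K] [NumberField K] (hK : IsImaginaryQuadratic K)
    (hH : SatisfiesHeegnerHypothesis N K) {P : (W.baseChange K).toAffine.Point}
    (hP : IsHeegnerPoint N W K P) (hnt : ¬ IsOfFinAddOrder P)
    (hpD : ¬ (3 : ℤ) ∣ NumberField.discr K) (hpN : ¬ 3 ^ 2 ∣ N)
    (hI : padicValNat 3 (AddSubgroup.zmultiples P).index ≤ 1)
    (hr : W.analyticRank = 1) {s : ℚ} (hs : shaAn W = (s : ℂ)) (hv : padicValRat 3 s = 2)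
    (hcard : Nat.card (W.selmerGroup (3 : ℤ)) = 27) : BSDp W 3 :=
  bsdp_of_mult_of_cha_of_card_selmer W 3 hCha hGZK hX.1 (by norm_num) hX.2.1 hK hH hP hnt
    (by exact_mod_cast hpD) hpN hI hr hs hv
    (by rw [show ((3 : ℕ) : ℤ) = 3 by norm_num]; simpa using hcard)

end ClassShapes

end Summit.BirchSwinnertonDyer.Rank1Residual.X11b

end
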